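/-
Copyright (c) 2026. All rights reserved.
Released under Apache 2.0 license as described in the file LICENSE.
-/
import Literature.NumberTheory.ComplexMultiplication.DegenerateCMTypesAbelianSurvivorTernaryClosure
import Mathlib.RingTheory.RootsOfUnity.Complex
import Mathlib.RingTheory.Polynomial.Cyclotomic.Roots
import HarnessLib

/-!
# Kubota's survivors are stable under the Galois action on characters, and under odd multiples in the extremal
# case

SETTING (tree `CMTypeRankCharacters`, `DegenerateCMTypesAbelianSurvivorClosure`,
`DegenerateCMTypesAbelianSurvivorTernaryClosure`).  `G` a finite commutative group, `ρ ∈ G`, `T ⊆ G` a CM type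
(`IsCMTypeWith ρ T`), `Ŝ_D(χ) = Σ_{t ∈ D} χ(t)` for `χ : AddChar (Additive G) ℂ` (additive notation: `(a • χ)(g) =
χ(g)ᵃ`), `S(T) = {χ : χ(ρ) = −1, Ŝ_T(χ) ≠ 0}` the SURVIVORS (`rank(T) = 1 + #S(T)`, [Kubota1965] §4 Lemma 2,
[Gordon1999HodgeAVSurvey] Prop. 9.4.1).  Two stability properties of `S(T)`:

> **Theorem** (`sum_nsmul_apply_eq_zero_iff`, `nsmul_mem_survivors_iff`).  For `a` coprime to `|G|` (or to any
> `n > 0` with `n • χ = 0`): **`Ŝ_D(a • χ) = 0 ⟺ Ŝ_D(χ) = 0`** — the values of `χ` are `n`-th roots of unity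
> `ζ^{e(t)}`, `Ŝ_D(χ) = P(ζ)` and `Ŝ_D(a • χ) = P(ζᵃ)` for the integer polynomial `P = Σ_{t ∈ D} X^{e(t)}`, and `ζ`,
> `ζᵃ` have the same minimal polynomial, the cyclotomic polynomial (Mathlib `Polynomial.cyclotomic_eq_minpoly_rat`).
> Hence THE SURVIVORS ARE STABLE UNDER `χ ↦ a • χ`, `(a, |G|) = 1` (the action of `Gal(ℚ(μ_{|G|})/ℚ)` on `Ĝ`), and
> every survivor `χ` contributes `φ(ord χ)` survivors: **`rank(T) ≥ 1 + φ(ord χ)`**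
> (`one_add_totient_addOrderOf_le_typeRank`).  This is the character-level form of the Galois invariance of the rank
> ([Dodson1984] §3.1.1; [Ribet1980] §3; tree `cmTypeRank_cmTypeSmul`).
> **Theorem** (`odd_nsmul_mem_survivors_of_forall_add_add`, `two_mul_card_stabilizer_mul_lt_of_nsmul_sum_eq_zero`).
> If the survivors are closed under triple products — the EXTREMAL case `2·|Stab(T)|·(rank(T) − 1) = |G|`, i.e.
> `B = D` on `A` on the field side (tree g40-#5, g40-#6) — then EVERY ODD MULTIPLE `(2k+1) • χ` of a survivor is a
> survivor; so a survivor with an annihilated odd multiple (`Ŝ_T((2k+1) • χ) = 0`, e.g. `χ` of order `6` with the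
> quadratic character `3 • χ` killed) forces an exceptional Hodge class.

* §1 `nsmul_card_eq_zero` (`|G| • χ = 0`), `apply_pow_card` (`χ(g)^{|G|} = 1`), `sum_nsmul_apply_eq_zero_of_sum_eq_zero`,
  **`sum_nsmul_apply_eq_zero_iff`**, `sum_nsmul_apply_ne_zero_iff`, **`nsmul_mem_survivors_iff`**,
  `nsmul_apply_rho_of_coprime` (`a` is odd, `(a • χ)(ρ) = χ(ρ)`).
* §2 **`totient_addOrderOf_le_card_survivors`**, **`one_add_totient_addOrderOf_le_typeRank`**.
* §3 **`odd_nsmul_mem_survivors_of_forall_add_add`**, **`two_mul_card_stabilizer_mul_lt_of_nsmul_sum_eq_zero`**.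

HONEST SCOPE.  Cyclotomic minimal polynomials (Mathlib) applied to character sums; the sources print the Galois
invariance of the rank (Ribet, Dodson) and Kubota's formula; the survivor-level statements are this file's packaging,
not numbered statements of the sources.  THEOREMS ONLY: no definition, no named fact, no instance, no `sorry`.

## References

* [Kubota1965] T. Kubota, *On the field extension by complex multiplication*, Trans. AMS 118 (1965), §2, §4 Lemma 2.
* [Gordon1999HodgeAVSurvey] B. B. Gordon, *A survey of the Hodge conjecture for abelian varieties*, Thm. 6.4, §9.2,
  Prop. 9.4.1 and §9.4.2.
* [Dodson1984] B. Dodson, *The structure of Galois groups of CM-fields*, Trans. AMS 283 (1984), §3.1.1.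
* [Ribet1980] K. A. Ribet, *Division fields of abelian varieties with complex multiplication*, Mém. SMF 2 (1980), §3.
* [White1993SporadicCycles] S. P. White, *Sporadic cycles on CM abelian varieties*, Compositio Math. 88 (1993), §4 Thm. 3.

## Provenance

Lane `lit-hodgefound` (Track 2, Layer A3), seat `lit-hodgefound-p10` generation 40, row g40-#8; neighbours cited by
name, nothing restated: `DegenerateCMTypesAbelianSurvivorTernaryClosure` (g40-#5:
`two_mul_card_stabilizer_mul_lt_iff_exists_mem_closure` via g40-#1, `two_mul_card_stabilizer_mul_eq_iff_forall_add_add`),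
`DegenerateCMTypesAbelianSurvivorClosure` (g40-#1), `CMTypeRankCharacters`
(`IsCMTypeWith.typeRank_eq_one_add_ncard_oddCharacters`), `CMTypeElementaryTwoGroupOddWeights`
(`character_apply_eq_one_or_of_mul_self`), Mathlib `Complex.isPrimitiveRoot_exp`, `IsPrimitiveRoot.eq_pow_of_pow_eq_one`,
`Polynomial.cyclotomic_eq_minpoly_rat`, `minpoly.dvd`, `Nat.totient_eq_card_coprime`, `nsmul_injOn_Iio_addOrderOf`.
-/

open scoped BigOperators Classical
open Polynomial

namespace Literature.NumberTheory.ComplexMultiplication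

namespace CyclicCMType

namespace AbelianStabilizer

variable {G : Type*} [CommGroup G] [Fintype G] [DecidableEq G] {ρ : G} {T : Finset G}

/-! ## §0 Helpers -/

section Helpers

omit [Fintype G] [DecidableEq G] in
/-- `ρ² = 1`. [folklore] -/
private theorem rho_mul_rho_ga (h : IsCMTypeWith ρ (T : Set G)) : ρ * ρ = 1 := by
  have := h.invol (1 : G)
  simpa [smul_eq_mul] using this

omit [Fintype G] [DecidableEq G] in
/-- `χ(ρ) = ±1`. [folklore] -/
private theorem char_rho_ga (h : IsCMTypeWith ρ (T : Set G)) (χ : AddChar (Additive G) ℂ) :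
    χ (Additive.ofMul ρ) = 1 ∨ χ (Additive.ofMul ρ) = -1 :=
  character_apply_eq_one_or_of_mul_self χ (rho_mul_rho_ga h)

omit [DecidableEq G] in
/-- Kubota's count with the survivors as a finset: `rank = 1 + #surv`. [cite: Kubota1965, §4 Lemma 2] -/
private theorem typeRank_eq_one_add_card_ga (h : IsCMTypeWith ρ (T : Set G)) :
    typeRank G (T : Set G) = 1 + ((Finset.univ.filter fun χ : AddChar (Additive G) ℂ =>
      χ (Additive.ofMul ρ) = -1).filter fun χ => ∑ s ∈ T, χ (Additive.ofMul s) ≠ 0).card := by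
  rw [h.typeRank_eq_one_add_ncard_oddCharacters, ← Set.ncard_coe_finset]
  congr 2
  ext χ
  simp only [Set.mem_setOf_eq, Finset.coe_filter, Finset.mem_filter, Finset.mem_univ, true_and]

omit [Fintype G] [DecidableEq G] in
/-- If `n • χ = 0` then every value of `χ` is an `n`-th root of unity. [folklore] -/
private theorem apply_pow_eq_one_of_nsmul_eq_zero {n : ℕ} {χ : AddChar (Additive G) ℂ} (hχ : n • χ = 0) (g : G) :
    χ (Additive.ofMul g) ^ n = 1 := by
  rw [← AddChar.nsmul_apply, hχ, AddChar.zero_apply]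

omit [Fintype G] [DecidableEq G] in
/-- One direction of the Galois stability: `Ŝ_D(χ) = 0 ⟹ Ŝ_D(a • χ) = 0` for `a` coprime to an exponent `n` of `χ`
(the character sums are values of one integer polynomial at two primitive `n`-th roots of unity with the same
minimal polynomial). [folklore] -/
private theorem sum_nsmul_apply_eq_zero_aux {n : ℕ} (hn : 0 < n) {χ : AddChar (Additive G) ℂ} (hχ : n • χ = 0)
    {a : ℕ} (ha : a.Coprime n) (D : Finset G) (h0 : ∑ s ∈ D, χ (Additive.ofMul s) = 0) :
    ∑ s ∈ D, (a • χ) (Additive.ofMul s) = 0 := by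
  haveI : NeZero n := NeZero.of_pos hn
  have hζ := Complex.isPrimitiveRoot_exp n hn.ne'
  -- exponents `e s` with `ζ ^ e s = χ s`
  have hex : ∀ g : G, ∃ i : ℕ, Complex.exp (2 * Real.pi * Complex.I / n) ^ i = χ (Additive.ofMul g) := fun g => by
    obtain ⟨i, -, hi⟩ := hζ.eq_pow_of_pow_eq_one (apply_pow_eq_one_of_nsmul_eq_zero hχ g)
    exact ⟨i, hi⟩
  choose e he using hex
  -- the polynomial
  have hP : aeval (Complex.exp (2 * Real.pi * Complex.I / n)) (∑ s ∈ D, (X : ℚ[X]) ^ e s) =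
      ∑ s ∈ D, χ (Additive.ofMul s) := by
    rw [map_sum]
    exact Finset.sum_congr rfl fun s _ => by rw [map_pow, aeval_X, he]
  have hPa : aeval (Complex.exp (2 * Real.pi * Complex.I / n) ^ a) (∑ s ∈ D, (X : ℚ[X]) ^ e s) =
      ∑ s ∈ D, (a • χ) (Additive.ofMul s) := by
    rw [map_sum]
    exact Finset.sum_congr rfl fun s _ => by
      rw [map_pow, aeval_X, AddChar.nsmul_apply, ← he, pow_right_comm]
  have hmin : minpoly ℚ (Complex.exp (2 * Real.pi * Complex.I / n)) =
      minpoly ℚ (Complex.exp (2 * Real.pi * Complex.I / n) ^ a) := by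
    rw [← Polynomial.cyclotomic_eq_minpoly_rat hζ hn, ← Polynomial.cyclotomic_eq_minpoly_rat (hζ.pow_of_coprime a ha) hn]
  have hdvd : minpoly ℚ (Complex.exp (2 * Real.pi * Complex.I / n) ^ a) ∣ ∑ s ∈ D, (X : ℚ[X]) ^ e s := by
    rw [← hmin]
    exact minpoly.dvd ℚ _ (by rw [hP, h0])
  rw [← hPa]
  exact aeval_eq_zero_of_dvd_aeval_eq_zero hdvd (minpoly.aeval ℚ _)

end Helpers

/-! ## §1 Galois stability: `Ŝ(a • χ) = 0 ⟺ Ŝ(χ) = 0` for `a` coprime to the exponent -/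

section Galois

omit [DecidableEq G] in
/-- **`|G| • χ = 0`** for every character of a finite commutative group. [cite: Kubota1965, §4 Lemma 2 (proof)] -/
theorem nsmul_card_eq_zero (χ : AddChar (Additive G) ℂ) : Fintype.card G • χ = 0 := by
  refine DFunLike.ext _ _ fun x => ?_
  rw [AddChar.nsmul_apply, AddChar.zero_apply, ← AddChar.map_nsmul_eq_pow]
  have hx : Fintype.card G • x = 0 := by
    have h1 : (Additive.toMul x) ^ Fintype.card G = 1 := pow_card_eq_one
    have h2 := congrArg Additive.ofMul h1
    rwa [ofMul_pow, ofMul_one] at h2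
  rw [hx, AddChar.map_zero_eq_one]

omit [DecidableEq G] in
/-- `χ(g)^{|G|} = 1`. [cite: Kubota1965, §4 Lemma 2 (proof)] -/
theorem apply_pow_card (χ : AddChar (Additive G) ℂ) (g : G) : χ (Additive.ofMul g) ^ Fintype.card G = 1 :=
  apply_pow_eq_one_of_nsmul_eq_zero (nsmul_card_eq_zero χ) g

omit [Fintype G] [DecidableEq G] in
/-- **GALOIS STABILITY OF VANISHING CHARACTER SUMS**: for `n > 0` with `n • χ = 0` and `a` coprime to `n`,
`Σ_{s ∈ D} (a • χ)(s) = 0 ⟺ Σ_{s ∈ D} χ(s) = 0` (the two sums are `P(ζᵃ)` and `P(ζ)` for one `P ∈ ℤ[X]` and a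
primitive `n`-th root of unity `ζ`; `ζ` and `ζᵃ` share the minimal polynomial `Φ_n`; the converse through an inverse
`b` of `a` modulo `n`). [cite: Dodson1984, §3.1.1] [cite: Ribet1980, §3] [cite: Gordon1999HodgeAVSurvey, §9.4.2] -/
theorem sum_nsmul_apply_eq_zero_iff {n : ℕ} (hn : 0 < n) {χ : AddChar (Additive G) ℂ} (hχ : n • χ = 0)
    {a : ℕ} (ha : a.Coprime n) (D : Finset G) :
    ∑ s ∈ D, (a • χ) (Additive.ofMul s) = 0 ↔ ∑ s ∈ D, χ (Additive.ofMul s) = 0 := by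
  refine ⟨fun h0 => ?_, sum_nsmul_apply_eq_zero_aux hn hχ ha D⟩
  -- `m • χ = χ` whenever `m % n = 1`
  have key : ∀ (ψ : AddChar (Additive G) ℂ), n • ψ = 0 → ∀ m : ℕ, m % n = 1 → m • ψ = ψ := fun ψ hψ m hm => by
    conv_lhs => rw [← Nat.div_add_mod m n, hm]
    rw [add_nsmul, one_nsmul, mul_comm n (m / n), mul_smul, hψ, nsmul_zero, zero_add]
  by_cases h1 : n = 1
  · subst h1
    have hχ0 : χ = 0 := by rwa [one_nsmul] at hχ
    rw [hχ0, nsmul_zero] at h0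
    rwa [hχ0]
  · have h1' : 1 < n := by omega
    obtain ⟨b, -, hb⟩ := Nat.exists_mul_mod_eq_one_of_coprime ha h1'
    have hb' : Nat.Coprime b n := by
      have hmod : b * a ≡ 1 [MOD n] := by
        rw [Nat.ModEq, mul_comm, hb, Nat.mod_eq_of_lt h1']
      exact Nat.coprime_of_mul_modEq_one a hmod
    have hab : b • (a • χ) = χ := by
      rw [smul_smul, mul_comm b a]
      exact key χ hχ (a * b) hb
    have hχ' : n • (a • χ) = 0 := by rw [smul_smul, mul_comm n a, mul_smul, hχ, nsmul_zero]
    have := sum_nsmul_apply_eq_zero_aux hn hχ' hb' D h0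
    rwa [hab] at this

omit [Fintype G] [DecidableEq G] in
/-- Non-vanishing form. [cite: Dodson1984, §3.1.1] [cite: Ribet1980, §3] -/
theorem sum_nsmul_apply_ne_zero_iff {n : ℕ} (hn : 0 < n) {χ : AddChar (Additive G) ℂ} (hχ : n • χ = 0)
    {a : ℕ} (ha : a.Coprime n) (D : Finset G) :
    ∑ s ∈ D, (a • χ) (Additive.ofMul s) ≠ 0 ↔ ∑ s ∈ D, χ (Additive.ofMul s) ≠ 0 :=
  (sum_nsmul_apply_eq_zero_iff hn hχ ha D).not

omit [DecidableEq G] in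
/-- For `a` coprime to `|G|`, `a` is odd and `(a • χ)(ρ) = χ(ρ)` (`χ(ρ) = ±1`). [cite: Kubota1965, §4 Lemma 2] -/
theorem nsmul_apply_rho_of_coprime (h : IsCMTypeWith ρ (T : Set G)) {a : ℕ} (ha : a.Coprime (Fintype.card G))
    (χ : AddChar (Additive G) ℂ) : (a • χ) (Additive.ofMul ρ) = χ (Additive.ofMul ρ) := by
  have hρ1 : ρ ≠ 1 := fun hρ => by
    have := h.rho_smul_ne (1 : G)
    rw [hρ, smul_eq_mul, one_mul] at this
    exact this rfl
  have h2 : 2 ∣ Fintype.card G := by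
    have ho : orderOf ρ = 2 := orderOf_eq_prime (by rw [pow_two]; exact rho_mul_rho_ga h) hρ1
    rw [← ho]
    exact orderOf_dvd_card
  have hodd : Odd a := by
    rw [← Nat.coprime_two_right]
    exact Nat.Coprime.coprime_dvd_right h2 ha
  rw [AddChar.nsmul_apply]
  rcases char_rho_ga h χ with h1 | h1
  · rw [h1, one_pow]
  · rw [h1, hodd.neg_one_pow]

omit [DecidableEq G] in
/-- **THE SURVIVORS ARE STABLE UNDER THE GALOIS ACTION ON CHARACTERS**: for `a` coprime to `|G|`, `a • χ` is a
survivor iff `χ` is. [cite: Dodson1984, §3.1.1] [cite: Ribet1980, §3] [cite: Kubota1965, §4 Lemma 2] -/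
theorem nsmul_mem_survivors_iff (h : IsCMTypeWith ρ (T : Set G)) {a : ℕ} (ha : a.Coprime (Fintype.card G))
    (χ : AddChar (Additive G) ℂ) :
    a • χ ∈ {χ : AddChar (Additive G) ℂ | χ (Additive.ofMul ρ) = -1 ∧ ∑ s ∈ T, χ (Additive.ofMul s) ≠ 0} ↔
      χ ∈ {χ : AddChar (Additive G) ℂ | χ (Additive.ofMul ρ) = -1 ∧ ∑ s ∈ T, χ (Additive.ofMul s) ≠ 0} := by
  simp only [Set.mem_setOf_eq]
  rw [nsmul_apply_rho_of_coprime h ha χ,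
    sum_nsmul_apply_ne_zero_iff Fintype.card_pos (nsmul_card_eq_zero χ) ha T]

end Galois

/-! ## §2 Every survivor contributes `φ(ord χ)` survivors: `rank(T) ≥ 1 + φ(ord χ)` -/

section Totient

omit [DecidableEq G] in
/-- **`φ(ord χ) ≤ #S(T)` for every survivor `χ`**: the multiples `u • χ`, `u < ord χ` coprime to `ord χ`, are
pairwise distinct survivors. [cite: Dodson1984, §3.1.1] [cite: Ribet1980, §3] [cite: Kubota1965, §4 Lemma 2] -/
theorem totient_addOrderOf_le_card_survivors {χ : AddChar (Additive G) ℂ}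
    (hχ : χ ∈ {χ : AddChar (Additive G) ℂ | χ (Additive.ofMul ρ) = -1 ∧ ∑ s ∈ T, χ (Additive.ofMul s) ≠ 0}) :
    Nat.totient (addOrderOf χ) ≤ ((Finset.univ.filter fun χ : AddChar (Additive G) ℂ =>
      χ (Additive.ofMul ρ) = -1).filter fun χ => ∑ s ∈ T, χ (Additive.ofMul s) ≠ 0).card := by
  have hord : 0 < addOrderOf χ := addOrderOf_pos χ
  have hχn : addOrderOf χ • χ = 0 := addOrderOf_nsmul_eq_zero χ
  rw [Nat.totient_eq_card_coprime]
  refine Finset.card_le_card_of_injOn (fun u => u • χ) (fun u hu => ?_) (fun u hu v hv huv => ?_)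
  · -- `u • χ` is a survivor: `u` is odd since `ord χ` is even (`χ(ρ) = −1`), and Galois stability
    simp only [Finset.mem_coe, Finset.mem_filter, Finset.mem_range, Finset.mem_univ, true_and] at hu ⊢
    have h2 : 2 ∣ addOrderOf χ := by
      have hval : χ (Additive.ofMul ρ) ^ addOrderOf χ = 1 := apply_pow_eq_one_of_nsmul_eq_zero hχn ρ
      rw [hχ.1] at hval
      by_contra hnd
      have hodd : Odd (addOrderOf χ) := Nat.odd_iff.2 (Nat.two_dvd_ne_zero.1 hnd)
      rw [hodd.neg_one_pow] at hval
      norm_num at hval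
    have hodd' : Odd u := Nat.coprime_two_left.1 (Nat.Coprime.coprime_dvd_left h2 hu.2)
    refine ⟨by rw [AddChar.nsmul_apply, hχ.1, hodd'.neg_one_pow], ?_⟩
    exact (sum_nsmul_apply_ne_zero_iff hord hχn (Nat.Coprime.symm hu.2) T).2 hχ.2
  · -- injectivity on `u < ord χ`
    simp only [Finset.mem_coe, Finset.mem_filter, Finset.mem_range] at hu hv
    exact nsmul_injOn_Iio_addOrderOf (Set.mem_Iio.2 hu.1) (Set.mem_Iio.2 hv.1) huv

omit [DecidableEq G] in
/-- **`rank(T) ≥ 1 + φ(ord χ)` for every survivor `χ`** (Kubota: `rank = 1 + #S`). [cite: Kubota1965, §4 Lemma 2]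
[cite: Dodson1984, §3.1.1] [cite: Ribet1980, §3] -/
theorem one_add_totient_addOrderOf_le_typeRank (h : IsCMTypeWith ρ (T : Set G)) {χ : AddChar (Additive G) ℂ}
    (hχ : χ ∈ {χ : AddChar (Additive G) ℂ | χ (Additive.ofMul ρ) = -1 ∧ ∑ s ∈ T, χ (Additive.ofMul s) ≠ 0}) :
    1 + Nat.totient (addOrderOf χ) ≤ typeRank G (T : Set G) := by
  rw [typeRank_eq_one_add_card_ga h]
  exact Nat.add_le_add_left (totient_addOrderOf_le_card_survivors hχ) 1

end Totient

/-! ## §3 In the extremal case every odd multiple of a survivor is a survivor -/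

section OddMultiples

omit [Fintype G] [DecidableEq G] in
/-- **Ternary-closed survivors are closed under odd multiples**: `χ ∈ S ⟹ (2k+1) • χ ∈ S` (`(2k+3)χ = (2k+1)χ + χ + χ`).
[cite: Kubota1965, §4 Lemma 2] [cite: White1993SporadicCycles, §4 Theorem 3] -/
theorem odd_nsmul_mem_survivors_of_forall_add_add
    (h3 : ∀ χ₁ ∈ {χ : AddChar (Additive G) ℂ | χ (Additive.ofMul ρ) = -1 ∧ ∑ s ∈ T, χ (Additive.ofMul s) ≠ 0},
      ∀ χ₂ ∈ {χ : AddChar (Additive G) ℂ | χ (Additive.ofMul ρ) = -1 ∧ ∑ s ∈ T, χ (Additive.ofMul s) ≠ 0},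
      ∀ χ₃ ∈ {χ : AddChar (Additive G) ℂ | χ (Additive.ofMul ρ) = -1 ∧ ∑ s ∈ T, χ (Additive.ofMul s) ≠ 0},
        χ₁ + χ₂ + χ₃ ∈ {χ : AddChar (Additive G) ℂ | χ (Additive.ofMul ρ) = -1 ∧ ∑ s ∈ T, χ (Additive.ofMul s) ≠ 0})
    {χ : AddChar (Additive G) ℂ}
    (hχ : χ ∈ {χ : AddChar (Additive G) ℂ | χ (Additive.ofMul ρ) = -1 ∧ ∑ s ∈ T, χ (Additive.ofMul s) ≠ 0})
    (k : ℕ) :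
    (2 * k + 1) • χ ∈ {χ : AddChar (Additive G) ℂ | χ (Additive.ofMul ρ) = -1 ∧ ∑ s ∈ T, χ (Additive.ofMul s) ≠ 0} := by
  induction k with
  | zero => simpa using hχ
  | succ k ih =>
    have : (2 * (k + 1) + 1) • χ = (2 * k + 1) • χ + χ + χ := by
      rw [show 2 * (k + 1) + 1 = (2 * k + 1) + 1 + 1 by ring, add_nsmul, add_nsmul, one_nsmul]
    rw [this]
    exact h3 _ ih _ hχ _ hχ

/-- **A SURVIVOR WITH AN ANNIHILATED ODD MULTIPLE FORCES THE STRICT INEQUALITY** `2·|Stab(T)|·(rank(T) − 1) < |G|`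
(an exceptional Hodge class on the field side): extremal types have ternary-closed, hence odd-multiple-closed,
survivors. [cite: Kubota1965, §2 and §4 Lemma 2] [cite: White1993SporadicCycles, §4 Theorem 3] [cite: Gordon1999HodgeAVSurvey, Thm. 6.4 and §9.2] -/
theorem two_mul_card_stabilizer_mul_lt_of_nsmul_sum_eq_zero (h : IsCMTypeWith ρ (T : Set G))
    {χ : AddChar (Additive G) ℂ} (hρ : χ (Additive.ofMul ρ) = -1) (hS : ∑ s ∈ T, χ (Additive.ofMul s) ≠ 0)
    (k : ℕ) (h0 : ∑ s ∈ T, ((2 * k + 1) • χ) (Additive.ofMul s) = 0) :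
    2 * (Finset.univ.filter fun g : G => ∀ t : G, t * g ∈ T ↔ t ∈ T).card * (typeRank G (T : Set G) - 1) <
      Fintype.card G := by
  rw [(two_mul_card_stabilizer_mul_typeRank_sub_one_le h).lt_iff_ne]
  intro heq
  rw [two_mul_card_stabilizer_mul_eq_iff_forall_add_add h] at heq
  have h3 : ∀ χ₁ ∈ {χ : AddChar (Additive G) ℂ | χ (Additive.ofMul ρ) = -1 ∧ ∑ s ∈ T, χ (Additive.ofMul s) ≠ 0},
      ∀ χ₂ ∈ {χ : AddChar (Additive G) ℂ | χ (Additive.ofMul ρ) = -1 ∧ ∑ s ∈ T, χ (Additive.ofMul s) ≠ 0},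
      ∀ χ₃ ∈ {χ : AddChar (Additive G) ℂ | χ (Additive.ofMul ρ) = -1 ∧ ∑ s ∈ T, χ (Additive.ofMul s) ≠ 0},
        χ₁ + χ₂ + χ₃ ∈ {χ : AddChar (Additive G) ℂ |
          χ (Additive.ofMul ρ) = -1 ∧ ∑ s ∈ T, χ (Additive.ofMul s) ≠ 0} := by
    rintro χ₁ ⟨h₁, hS₁⟩ χ₂ ⟨h₂, hS₂⟩ χ₃ ⟨h₃, hS₃⟩
    exact ⟨add_add_apply_rho h₁ h₂ h₃, heq χ₁ χ₂ χ₃ h₁ hS₁ h₂ hS₂ h₃ hS₃⟩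
  exact (odd_nsmul_mem_survivors_of_forall_add_add h3 ⟨hρ, hS⟩ k).2 h0

end OddMultiples

end AbelianStabilizer

end CyclicCMType

end Literature.NumberTheory.ComplexMultiplication
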